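import Mathlib
import Summits.PneNP.PneNP.Theses.RamseyUncertifiable
import Literature.Combinatorics.SimpleGraph.RamseyNumbers
import Literature.Computability.MetaComplexity.Resolution

/-!
Sketch for crux-ideate stmt-PneNP-9818 (RegularResolutionRung), ideator 2, round 1.
First-lemma signatures for the idea cards (they need not be proved; they must elaborate).
-/

namespace Summit.PneNP.PneNP.Cruxes.RegularResolutionRung.Ideator2

open Finset

/-- Common neighbourhood of a vertex set `R` in `G` (as a finset of `Fin n`). -/
def commonNbrs {n : ℕ} (G : SimpleGraph (Fin n)) [DecidableRel G.Adj] (R : Finset (Fin n)) :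
    Finset (Fin n) :=
  univ.filter fun w => ∀ u ∈ R, G.Adj u w

/-- The clique-concept count `N(G)`: number of distinct common neighbourhoods `N̂(R)` of cliques
`R` of `G` (ABdRLNR's `|I(G)|` counted as vertex sets). -/
def conceptCount {n : ℕ} (G : SimpleGraph (Fin n)) [DecidableRel G.Adj] : ℕ :=
  (((univ : Finset (Finset (Fin n))).filter fun R => ∀ u ∈ R, ∀ v ∈ R, u ≠ v → G.Adj u v).image
    (commonNbrs G)).card

/-- CARD supergraph-concept-shadow, FIRST LEMMA (the "shadow theorem", provable now):
every 2-Ramsey graph has quasi-polynomially many clique-concepts. -/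
def ConceptSupersaturation : Prop :=
  ∃ ε : ℝ, 0 < ε ∧ ∃ n₀ : ℕ, ∀ n ≥ n₀, ∀ (G : SimpleGraph (Fin n)) [DecidableRel G.Adj],
    G.CliqueFree (Nat.clog 2 (n ^ 2)) → Gᶜ.CliqueFree (Nat.clog 2 (n ^ 2)) →
      (n : ℝ) ^ (ε * Real.logb 2 n) ≤ (conceptCount G : ℝ)

/-- Supergraph-closed form (what bounds ALL refutations produced by ABdRLNR's Algorithm 1 /
Prop. 3.1 + Fact 3.2 + Prop. 3.4): every `K_k`-free supergraph of a 2-Ramsey graph is again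
2-Ramsey, hence has many concepts.  `N*(G) := min over such G'` is the invariant of the card. -/
def SupergraphConceptBound : Prop :=
  ∃ ε : ℝ, 0 < ε ∧ ∃ n₀ : ℕ, ∀ n ≥ n₀, ∀ (G G' : SimpleGraph (Fin n)) [DecidableRel G'.Adj],
    G.CliqueFree (Nat.clog 2 (n ^ 2)) → Gᶜ.CliqueFree (Nat.clog 2 (n ^ 2)) →
      G ≤ G' → G'.CliqueFree (Nat.clog 2 (n ^ 2)) →
        (n : ℝ) ^ (ε * Real.logb 2 n) ≤ (conceptCount G' : ℝ)

/-- Structural input of the shadow theorem ("budget descent"): a polynomial-size induced piece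
of any 2-Ramsey graph with no complete bipartite pair whose two sides are near-full-size. -/
def BicliqueFreeCore : Prop :=
  ∀ δ : ℝ, 0 < δ → δ < 1 → ∃ c : ℝ, 0 < c ∧ ∃ n₀ : ℕ, ∀ n ≥ n₀, ∀ (G : SimpleGraph (Fin n)),
    G.CliqueFree (Nat.clog 2 (n ^ 2)) → Gᶜ.CliqueFree (Nat.clog 2 (n ^ 2)) →
      ∃ P : Finset (Fin n), (n : ℝ) ^ c ≤ (P.card : ℝ) ∧
        ∀ T Z : Finset (Fin n), T ⊆ P → Z ⊆ P → Disjoint T Z →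
          (P.card : ℝ) ^ (1 - δ) ≤ (T.card : ℝ) → (P.card : ℝ) ^ (1 - δ) ≤ (Z.card : ℝ) →
            ∃ t ∈ T, ∃ z ∈ Z, ¬ G.Adj t z

/-- The unary clique CNF of the crux, verbatim (blocks `i < k`, variable `i*n+v`). -/
def cliqueCNF (n k : ℕ) (adj : Fin n → Fin n → Bool) : Literature.Computability.Complexity.CNF ℕ :=
  ((List.range k).map fun i => (List.finRange n).map fun v => (i * n + (v : ℕ), true)) ++
  ((List.range k).flatMap fun i => (List.finRange n).flatMap fun u => (List.finRange n).flatMap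
    fun v => if u < v then [[(i * n + (u : ℕ), false), (i * n + (v : ℕ), false)]] else []) ++
  ((List.range k).flatMap fun i => (List.range k).flatMap fun j => (List.finRange n).flatMap
    fun u => (List.finRange n).flatMap fun v =>
      if i ≠ j ∧ adj u v = false then [[(i * n + (u : ℕ), false), (j * n + (v : ℕ), false)]] else [])

/-- ABdRLNR Prop. 3.1 + Fact 3.2 in the crux's encoding (an upper bound, to be proved as support):
any `K_k`-free supergraph `G'` of `G` yields a REGULAR refutation of `Clique(G,k)` of length at
most `N(G') · n^4` (crude polynomial factor in place of `k² n²`). -/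
def RegularUpperBoundByConcepts : Prop :=
  ∃ n₀ : ℕ, ∀ n ≥ n₀, ∀ k : ℕ, 1 ≤ k → k ≤ n →
    ∀ (G G' : SimpleGraph (Fin n)) [DecidableRel G.Adj] [DecidableRel G'.Adj],
      G ≤ G' → G'.CliqueFree k →
        ∃ π : List (Literature.Computability.MetaComplexity.ResLine ℕ),
          Literature.Computability.MetaComplexity.IsResRefutation
              (cliqueCNF n k fun u v => decide (G.Adj u v)) π ∧
            Literature.Computability.MetaComplexity.IsRegular π ∧
            π.length ≤ conceptCount G' * n ^ 4

/-- CONCEPT RIGIDITY (the bet of card supergraph-concept-shadow): for graphs whose clique number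
is at least a `1/ξ₀` fraction of `k`, every regular refutation of `Clique(G,k)` has length at least
`N*(G)^c / n^C`, where `N*` is the minimum concept count over `K_k`-free supergraphs. Stated with
the supergraph quantifier inside: some `K_k`-free supergraph has few concepts. -/
def ConceptRigidity : Prop :=
  ∀ ξ₀ : ℕ, 1 ≤ ξ₀ → ∃ c : ℝ, 0 < c ∧ ∃ C : ℕ, ∃ n₀ : ℕ, ∀ n ≥ n₀, ∀ k : ℕ, 1 ≤ k → k ≤ n →
    ∀ (G : SimpleGraph (Fin n)) [DecidableRel G.Adj], G.CliqueFree k → ¬ G.CliqueFree (k / ξ₀) →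
      ∀ π : List (Literature.Computability.MetaComplexity.ResLine ℕ),
        Literature.Computability.MetaComplexity.IsResRefutation
            (cliqueCNF n k fun u v => decide (G.Adj u v)) π →
          Literature.Computability.MetaComplexity.IsRegular π →
            ∃ (G' : SimpleGraph (Fin n)) (_ : DecidableRel G'.Adj), G ≤ G' ∧ G'.CliqueFree k ∧
              ((conceptCount G' : ℝ)) ^ c ≤ (π.length : ℝ) * (n : ℝ) ^ C

/-- Composition check (informal target): ConceptRigidity ∧ SupergraphConceptBound → crux.
We only record the intended implication as a Prop; the proof needs `ω(G) ≥ k/10` for 2-Ramsey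
graphs (Erdős–Szekeres counting, `exists_clique_or_indep_of_choose_le_card`). -/
def ShadowLineCloses : Prop :=
  ConceptRigidity → SupergraphConceptBound →
    Summit.PneNP.PneNP.Theses.RamseyUncertifiable.RegularResolutionRung

-- sanity: the Erdős–Szekeres finset lemma we lean on exists
#check @Literature.Combinatorics.SimpleGraph.exists_clique_or_indep_of_choose_le_card

end Summit.PneNP.PneNP.Cruxes.RegularResolutionRung.Ideator2
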